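import Literature.MathematicalPhysics.QuantumFieldTheory.Balaban1983to89.Beta.RemainderDecay190TwoGrid
import Literature.MathematicalPhysics.QuantumFieldTheory.Balaban1983to89.B6MainResultsOneLevel

/-!
# [Balaban1987RG1] p. 282 ⟵ [Balaban1984PropagatorsI] (1.63): NODE D's socket `Data190` INHABITED BY BAŁABAN'S FLAT
LINEARIZED MINIMIZER `H_k` (zero background), with ONE constant record for every mesh `η = L^{−k}` and every volume
(`Beta.RemainderDecay190TwoGridHk`)

HONEST FRAMING (cell rule, page 1 of everything).  Discharging `BetaPertH` makes Bałaban's UV stability UNCONDITIONAL —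
a real constructive-QFT result; it is NOT the continuum limit and NOT the Clay problem.  This module discharges NOTHING
of `BetaPertH`.  Row (D4) of the wall (`RemainderConst` ⇐ the (β) leaves) consumes, at NODE D, a (190)-side datum
`RemainderDecay190.Data190` — the B-derivative `(δ/δB)𝐇_k(□₀,0)` of the restricted minimizer WITH the block decay (190)
of [Balaban1985Variational] and the (4.4)-dictionary of [I].  Until now the socket was inhabited only by MODEL operators
with hypothesized letters (generations 91–100 of this lineage).  Here it is inhabited, on the two-grid carrier of
`RemainderDecay190TwoGrid`, by one of BAŁABAN'S OWN OPERATORS: the flat (`U = 1`) linearized minimizer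
`H_k : B ↦ the minimizer of the fine action under Q_kA = B` of [B5] (1.59)–(1.63), as the tree's typed torus operator
`B5Hk163Torus.HkOp` (lit-balaban b05 ∕ node X10, 2026-08-19, with `Q_kH_k = I` `B5Hk163Torus.QvOp_mul_HkOp`), whose
kernel decays exponentially with DIMENSION-ONLY constants (`B6MainResultsOneLevel.norm_HkOp_bpt_le`, the first entry
of [Balaban1984PropagatorsII] Cor. 2.8 (2.151) on the one-scale torus).  WHAT THIS IS: the zero-background value of the
(182) letter `H₀` of [15] Sect. G ((129): `H₀ = GQ*(QGQ*)⁻¹(L^jη)⁻¹`; at `B = 0`, `U = 1` the (179) chart's derivative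
`(δ/δB)𝓗` REDUCES to `H₀` only if `𝔄₀ = (δ/δB)𝒜₀` and the Sect. C correction vanish there — a reading of [15]
pp. 306–308 recorded in the OWNER memo `HOME/b2b-balaban-beta-an4/FLAT-LETTERS-LOCATED.md` §§8–13, NOT certified here),
read into NODE D's socket with constants uniform in the step k and the volume.  WHAT THIS IS NOT: not the (182)
derivative in a background field, not (189), not the multi-level operators, not Bałaban's `O(1)`, `δ₀` (the constants
are the b05 lineage's crude dimension-only ones).  Carrier plumbing + a by-name transcription; NOT summit progress.

ABSOLUTE RULE (cell).  "No internally-minted statement may enter as a cited fact. Every hypothesis is either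
kernel-proved in this package or a verbatim quotation of a PUBLISHED theorem with page reference. The manuscript(s)
under audit are NOT citable for their own disputed steps — they are the thing under adjudication; programme-internal
(2001/route/tribunal) claims are never citable."  Every declaration below is a proved theorem; no `def` is introduced;
NO hypothesis of printed shape remains (the outputs are hypothesis-free except for numerics on `q`).

CITATION HEADER (lean-in-tree rule 2026-08-18).  [I] = T. Bałaban, *Renormalization group approach to lattice gauge
field theories. I*, Commun. Math. Phys. **109**, 249–301 (1987) [Balaban1987RG1]: p. 282 (*"The norm in (4.4) of the
expression ⟨(δ^{n(p)}/δB^{n(p)})𝐇_j(□₀, 0), ⊗_{i∈N(p)}B_i⟩ can be estimated by B₃∏_{i∈N(p)}∣B_i∣, and if one of the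
functions B_i is localized outside the domain X, then we have the additional exponential factor
exp(−δ₀dist^{(ξ)}(X, supp B_i))"*), (4.35) p. 290 (the test vectors), (4.4) p. 281; [B5] = T. Bałaban, *Propagators and
renormalization transformations for lattice gauge theories. I*, Commun. Math. Phys. **95**, 17–40 (1984)
[Balaban1984PropagatorsI]: (1.59)–(1.60) p. 27 (H_k as the minimizer `A = H_kB` of the quadratic action under
`Q_kA = B`), (1.63) p. 28 (*"We have the following momentum representation for H_kB"*), p. 29 (*"Using (1.60), or
better (1.63), we can verify all the properties of H_kB: Q_kH_kB = B, …"*), (1.6) p. 18 (blocks B(y)); [3] =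
T. Bałaban, *Propagators and renormalization transformations for lattice gauge theories. II*, Commun. Math. Phys.
**96**, 223–250 (1984) [Balaban1984PropagatorsII]: Cor. 2.8 (2.150)–(2.151) p. 249 (*"|H(b, c)| ≤ O(1)e^{−δ₅d(y,c₋)}"*
for `b ∈ Δ(y)` — the kernel decay of `H = GQ*(QGQ*)⁻¹`, on one scale = `H_k`), (2.46) p. 231, (2.51) p. 232, Lemma 2.1
(2.61) p. 234; [15] = T. Bałaban, *The variational problem and background fields …*, Commun. Math. Phys. **102**,
277–309 (1985) [Balaban1985Variational]: (129) p. 298 (`H₀`), (182) p. 307, (190) p. 308.  Locations only; the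
mathematics used is the tree's `B5Hk163Torus` ∕ `B6MainResultsOneLevel` (kernel-checked, hypothesis-free) BY NAME.

## What is PROVED here (kernel-checked; 0 sorry; no `def`; no hypothesis of printed shape)

(K1) `pl1_sub_le_mul_distSite` — on a cubic torus the periodic ℓ¹ distance of the (D4) road (`B12Decay510Torus.pl1`)
is at most `D ×` the sup circular distance of the b05 lineage (`B5Prop12FieldsLattice.distSite`); `card_fibre_fst` —
the 1-forms over a site number `D`; `CH0_nonneg`.
(K2) **`rowMajorant_HkOp`** — THE ROW MAJORANT OF `H_k` in the road's currency: for every mesh `n ≥ 1`, every cubic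
unit torus with `s` sites per direction, every coarse 1-form `B` and every fine bond `(x, μ)`,
`‖(H_kB)_μ(x)‖ ≤ Σ_{(c,λ)} CH0(D)·e^{−(rateH(D)∕D)‖blockOf x − c‖}·‖B_λ(c)‖` (`B6MainResultsOneLevel.norm_HkOp_bpt_le` BY
NAME + (K1)); constants `CH0 D = MG163(D)·periodConst(κ₁₆₃(D), D−1)`, `rateH D = κ₁₆₃(D)∕D` — DIMENSION ONLY.
(K3) **`exists_data190_twoGrid_HkOp`** — NODE D's SOCKET INHABITED BY `H_k`: for every mesh `nm` (= L^k), every cube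
side `M`, every volume sequence `N`, every source direction `μ₀` and every constant record `q` with the NUMERICS
`0 < q.σ`, `c₀(q.σ∕δr)^D ≤ q.cR`, `1 ≤ q.κB`, `q.δ15 ≤ 4·rateH(D)∕D`, `CH0(D)·D·K₁(D, rateH(D)∕(2D)) ≤ q.Cst`, `1 ≤ q.m`,
`0 ≤ q.θ`, `q.θ·M ≤ 1`: `∃ 𝒟 : Data190 D M N (fun n => T_η(n) × Fin D → ℂ) q` whose operator IS `H_k`
(`𝒟.hn n X̄ y = (p ↦ cube(blockOf p.1) ∈ X̄ ? (H_k δ_{(y,μ₀)})(p) : 0)` — the (4.35) test vector = the column of `H_k` at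
the unit source 1-form `δ_{(y,μ₀)}`, restricted to the fine bonds over X̄).
(K4) **`exists_consts190_twoGrid_HkOp`** — ONE CONSTANT RECORD FOR ALL STEPS AND VOLUMES: an explicit
`q⋆(D, M) : Consts190` (`Cst = CH0·D·K₁`, `δ15 = 4ρ`, `σ = τ = ρ∕4`, `cR = c₀(ρ, ¼)^D`, `m = κB = 1`, `θ = 1∕M`,
`ρ = rateH(D)∕D`) with `q⋆.Valid (ρ∕(4M))` (the chain's compatibility clause `Consts190.Valid`, at the DERIVED p. 282
rate `δ₀ = ρ∕(4M)`) such that (K3) holds with `q⋆` for EVERY mesh, volume sequence and direction — the uniformity of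
[15]'s constants in the step DISPLAYED by the chain as a hypothesis shape (`RemainderDecay190` docstring) is here a
THEOREM for the flat `H_k`.

## What is NOT claimed

* That `H_k` IS the (182) derivative `(δ/δB)𝓗_k(□₀,0)` of [I] (4.35) at zero background (memo reading, see above), or
  anything at non-zero background ∕ for the actual RG flow: the chain's (4.35) representation `hrepr` (NODE B∕E) is
  where that identification would be consumed; it is untouched.  Not (189), not (181), not the multi-level (2.46)
  geometry (one scale of M-cubes), not the `∇`∕Hölder∕`Δ` entries of (190)∕(4.4) (one sup size, as on every model
  instance of the road).  The rate `δ₀ = rateH(D)∕(4DM)` of (K4) is the b05 lineage's crude rate divided by the carrier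
  conversions — a kernel-true number, not Bałaban's δ₀.
* No `Literature` fact is minted; no `axiom`, no `sorry`.  NOT summit progress, NOT the continuum limit, NOT Clay.
-/

namespace Literature.MathematicalPhysics.QuantumFieldTheory.Balaban1983to89.Beta.RemainderDecay190TwoGridHk

open Literature.MathematicalPhysics.QuantumFieldTheory.Balaban1983to89 B11SectG B6RandomWalk
open Literature.MathematicalPhysics.QuantumFieldTheory.Balaban1983to89.B9Thm34Ext (toB6)
open Literature.MathematicalPhysics.QuantumFieldTheory.Balaban1983to89.B9Thm37GlueTorus (torusGeom tdist1)
open Literature.MathematicalPhysics.QuantumFieldTheory.Balaban1983to89.B5TorusCover (UT)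
open Literature.MathematicalPhysics.QuantumFieldTheory.Balaban1983to89.TreeLengthTorus (TPt TDom tsys)
open Literature.MathematicalPhysics.QuantumFieldTheory.Balaban1983to89.B12Decay510Window (K₁ K₁_nonneg)
open Literature.MathematicalPhysics.QuantumFieldTheory.Balaban1983to89.B12Decay510Torus
  (pabs pabs_eq_natAbs pl1 pl1_nonneg pl1_eq_sum tcubeOf)
open Literature.MathematicalPhysics.QuantumFieldTheory.Balaban1983to89.B5Prop11Plancherel (Tor fine)
open Literature.MathematicalPhysics.QuantumFieldTheory.Balaban1983to89.B5Prop12FieldsLattice (distSite distSite_nonneg)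
open Literature.MathematicalPhysics.QuantumFieldTheory.Balaban1983to89.B5Block118 (bpt)
open Literature.MathematicalPhysics.QuantumFieldTheory.Balaban1983to89.B5G115SupBound (exists_eq_bpt_blockOf)
open Literature.MathematicalPhysics.QuantumFieldTheory.Balaban1983to89.B5Hk163Torus (HkOp HkOp_mulVec hker)
open Literature.MathematicalPhysics.QuantumFieldTheory.Balaban1983to89.B5Hk163Strip (kappa163 kappa163_pos)
open Literature.MathematicalPhysics.QuantumFieldTheory.Balaban1983to89.B6MainResultsOneLevel
  (CH0 rateH EH norm_HkOp_bpt_le)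
open Literature.MathematicalPhysics.QuantumFieldTheory.Balaban1983to89.Beta.RemainderDecay190 (Data190 Consts190)
open Literature.MathematicalPhysics.QuantumFieldTheory.Balaban1983to89.Beta.RemainderDecay190TwoGrid
  (exists_data190_twoGrid_of_rowMajorant)

open scoped Matrix

noncomputable section

variable {d : ℕ}

/-! ## 1. Carrier conversions: the road's periodic ℓ¹ distance against b05's sup circular distance; fibre count -/

section Conversions

/-- **ℓ¹ ≤ D × ℓ^∞ on the cubic torus**: for unit-lattice points `y, c` of the torus with `s` sites per direction
(dimension `D = d + 1`), the road's periodic ℓ¹ distance `‖y − c‖ = Σ_i ∣y_i − c_i∣_s` (`B12Decay510Torus.pl1`) is at most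
`D·` the b05 lineage's sup circular distance `distSite` ([B5] (1.110): *"e^{−δ₀|y−y′|}"*, `|·|` the sup distance in
units). [cite: Balaban1984PropagatorsI, (1.110) p.35; Balaban1984PropagatorsII, (2.46) p.231] -/
theorem pl1_sub_le_mul_distSite (s : ℕ) [NeZero s] (y c : Tor (fun _ : Fin (d + 1) => s)) :
    pl1 (y - c) ≤ ((d : ℝ) + 1) * distSite (fun _ : Fin (d + 1) => s) y c := by
  rw [pl1_eq_sum]
  have h : ∀ i : Fin (d + 1), (pabs ((y - c) i) : ℝ) ≤ distSite (fun _ : Fin (d + 1) => s) y c := fun i => by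
    rw [pabs_eq_natAbs, Pi.sub_apply]
    unfold distSite
    have hle : ((y i - c i).valMinAbs).natAbs ≤
        Finset.univ.sup (fun μ : Fin (d + 1) => ((y μ - c μ).valMinAbs).natAbs) :=
      Finset.le_sup (f := fun μ : Fin (d + 1) => ((y μ - c μ).valMinAbs).natAbs) (Finset.mem_univ i)
    exact_mod_cast hle
  calc ∑ i : Fin (d + 1), (pabs ((y - c) i) : ℝ)
      ≤ ∑ _i : Fin (d + 1), distSite (fun _ : Fin (d + 1) => s) y c := Finset.sum_le_sum fun i _ => h i
    _ = ((d : ℝ) + 1) * distSite (fun _ : Fin (d + 1) => s) y c := by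
        rw [Finset.sum_const, Finset.card_univ, Fintype.card_fin, nsmul_eq_mul]; push_cast; ring

/-- **The 1-forms over a site**: the fibre of `Prod.fst` over a point has exactly `card` (second factor) elements — for
the bond carrier `T₁ × Fin D`, `D` bonds per site ([3] p. 248: *«sites replaced by bonds»*; the kernel `H(b, c)` of (2.150) is
indexed by bonds). [cite: Balaban1984PropagatorsII, (2.150) p.249, p.248] [folklore] -/
theorem card_fibre_fst {α β : Type} [Fintype α] [Fintype β] [DecidableEq α] (y : α) :
    (Finset.univ.filter fun b : α × β => b.1 = y).card = Fintype.card β := by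
  have h : (Finset.univ.filter fun b : α × β => b.1 = y) = ({y} : Finset α) ×ˢ (Finset.univ : Finset β) := by
    ext ⟨a, b⟩
    simp [eq_comm]
  rw [h, Finset.card_product, Finset.card_singleton, one_mul, Finset.card_univ]

/-- `0 ≤ CH0 D` for `D ≥ 1` (the sup constant of `|H(b,c)|`, [3] (2.151) first entry; read off the kernel bound
`B6MainResultsOneLevel.norm_HkOp_bpt_le` on the one-point torus). [cite: Balaban1984PropagatorsII, Cor. 2.8 (2.151) p.249] -/
theorem CH0_nonneg (d : ℕ) : 0 ≤ CH0 (d + 1) := by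
  have h := norm_HkOp_bpt_le 1 (fun _ : Fin (d + 1) => 1) 0 0 (fun _ => 0) 0 0
  have hE : 0 < EH (fun _ : Fin (d + 1) => 1) 0 0 := Real.exp_pos _
  have h0 : 0 * EH (fun _ : Fin (d + 1) => 1) 0 0 ≤ CH0 (d + 1) * EH (fun _ : Fin (d + 1) => 1) 0 0 := by
    rw [zero_mul]; exact (norm_nonneg _).trans h
  exact le_of_mul_le_mul_right h0 hE

/-- `0 < rateH D ∕ D` for `D = d + 1` (the decay rate of `H_k` per unit of the road's ℓ¹ distance; `rateH` is the b05∕B6 lineage's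
reading of the δ₅ of (2.151)). [cite: Balaban1984PropagatorsII, Cor. 2.8 (2.151) p.249] [folklore] -/
theorem rateH_div_pos (d : ℕ) : 0 < rateH (d + 1) / ((d : ℝ) + 1) := by
  unfold rateH
  have h1 : (0 : ℝ) < (d : ℝ) + 1 := by positivity
  have h2 : 0 < kappa163 (d + 1) / ((d + 1 : ℕ) : ℝ) := div_pos (kappa163_pos _) (by positivity)
  exact div_pos h2 h1

end Conversions

/-! ## 2. The row majorant of `H_k` in the road's currency -/

section RowMajorant

variable (n : ℕ) [NeZero n] (s : ℕ) [NeZero s]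

/-- **THE ROW MAJORANT OF BAŁABAN'S FLAT `H_k`** on the cubic torus family (mesh `η = 1∕n`, unit torus with `s` sites per
direction, dimension `D = d + 1`): for every coarse 1-form `B` and every fine bond `(x, μ)`,
`‖(H_kB)_μ(x)‖ ≤ Σ_{(c,λ)} CH0(D)·e^{−(rateH(D)∕D)·‖blockOf x − c‖}·‖B_λ(c)‖` — the kernel bound
`‖H_k((n·y + r, μ), (c, λ))‖ ≤ CH0·e^{−rateH·|y − c|}` of `B6MainResultsOneLevel.norm_HkOp_bpt_le` ([3] (2.151) first
entry, constants dimension-only, uniform in `n` and in the torus) at `y = blockOf x` ([B5] (1.6): every fine site is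
`n·y + r`), the sup distance converted into the road's ℓ¹ distance (§1).
[cite: Balaban1984PropagatorsII, Cor. 2.8 (2.151) p.249, (2.51) p.232; Balaban1984PropagatorsI, (1.63) p.28, (1.6) p.18] -/
theorem rowMajorant_HkOp (B : Tor (fun _ : Fin (d + 1) => s) × Fin (d + 1) → ℂ)
    (p : Tor (fine n (fun _ : Fin (d + 1) => s)) × Fin (d + 1)) :
    ‖(HkOp n (fun _ : Fin (d + 1) => s) *ᵥ B) p‖ ≤
      ∑ b : Tor (fun _ : Fin (d + 1) => s) × Fin (d + 1),
        CH0 (d + 1) * Real.exp (-(rateH (d + 1) / ((d : ℝ) + 1)) *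
          pl1 (B5Blocks16.blockOf n (fun _ : Fin (d + 1) => s) p.1 - b.1)) * ‖B b‖ := by
  obtain ⟨x, μ⟩ := p
  obtain ⟨r, hr⟩ := exists_eq_bpt_blockOf n (fun _ : Fin (d + 1) => s) x
  rw [HkOp_mulVec, Fintype.sum_prod_type]
  refine (norm_sum_le _ _).trans (Finset.sum_le_sum fun c _ => ?_)
  refine (norm_sum_le _ _).trans (Finset.sum_le_sum fun lam _ => ?_)
  rw [norm_mul]
  refine mul_le_mul_of_nonneg_right ?_ (norm_nonneg _)
  have h1 : ‖hker n (fun _ : Fin (d + 1) => s) μ lam x c‖ ≤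
      CH0 (d + 1) * EH (fun _ : Fin (d + 1) => s) (B5Blocks16.blockOf n (fun _ : Fin (d + 1) => s) x) c := by
    have h := norm_HkOp_bpt_le n (fun _ : Fin (d + 1) => s) (B5Blocks16.blockOf n (fun _ : Fin (d + 1) => s) x) c r μ lam
    rw [← hr] at h
    exact h
  refine h1.trans (mul_le_mul_of_nonneg_left ?_ (CH0_nonneg d))
  show Real.exp (-(rateH (d + 1) * distSite (fun _ : Fin (d + 1) => s) (B5Blocks16.blockOf n (fun _ : Fin (d + 1) => s) x) c))
    ≤ Real.exp (-(rateH (d + 1) / ((d : ℝ) + 1)) * pl1 (B5Blocks16.blockOf n (fun _ : Fin (d + 1) => s) x - c))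
  apply Real.exp_le_exp.mpr
  have hb := pl1_sub_le_mul_distSite s (B5Blocks16.blockOf n (fun _ : Fin (d + 1) => s) x) c
  have hρ : 0 ≤ rateH (d + 1) / ((d : ℝ) + 1) := (rateH_div_pos d).le
  have hD : (0 : ℝ) < (d : ℝ) + 1 := by positivity
  have hmul := mul_le_mul_of_nonneg_left hb hρ
  have e : rateH (d + 1) / ((d : ℝ) + 1) * (((d : ℝ) + 1) * distSite (fun _ : Fin (d + 1) => s)
      (B5Blocks16.blockOf n (fun _ : Fin (d + 1) => s) x) c) =
      rateH (d + 1) * distSite (fun _ : Fin (d + 1) => s) (B5Blocks16.blockOf n (fun _ : Fin (d + 1) => s) x) c := by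
    field_simp
  rw [e] at hmul
  linarith

end RowMajorant

/-! ## 3. NODE D's socket inhabited by `H_k`; ONE constant record for all steps and volumes -/

section Socket

variable {Mc : ℕ} [NeZero Mc] {N : ℕ → ℕ} [∀ n, NeZero (N n)]

/-- **NODE D's SOCKET `Data190` INHABITED BY BAŁABAN'S FLAT `H_k`** (the two-grid join certificate
`RemainderDecay190TwoGrid.exists_data190_twoGrid_of_rowMajorant` at `T n := H_k` on the torus with `N n·M` unit sites
per direction and mesh `1∕nm`, B-data = coarse 1-forms `T₁ × Fin D → ℂ` (fibre multiplicity `D`), configurations = fine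
1-forms `T_η × Fin D → ℂ`, δ sources `δ_{(y,μ₀)}` in the fixed direction `μ₀`, row majorant = §2): under the NUMERICS
`0 < q.σ`, `c₀(q.σ∕δr)^D ≤ q.cR` (some `δr > 0`), `1 ≤ q.κB`, `q.δ15 ≤ 4·rateH(D)∕D`,
`CH0(D)·D·K₁(D, rateH(D)∕(2D)) ≤ q.Cst`, `1 ≤ q.m`, `0 ≤ q.θ`, `q.θ·M ≤ 1` — for EVERY mesh `nm`, every volume sequence
`N`: `∃ 𝒟 : Data190 D M N (fun n => T_η × Fin D → ℂ) q` with
`𝒟.hn n X̄ y = (p ↦ cube(blockOf p.1) ∈ X̄ ? (H_k δ_{(y,μ₀)})(p) : 0)`.  Hypothesis-free in everything printed.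
[cite: Balaban1987RG1, p.282, (4.35) p.290, (4.4) p.281; Balaban1984PropagatorsI, (1.63) p.28, p.29; Balaban1984PropagatorsII, Cor. 2.8 (2.151) p.249, (2.61) p.234; Balaban1985Variational, (190) p.308, (129) p.298] -/
theorem exists_data190_twoGrid_HkOp (I : Type) (i₀ : I) (η L Mg R : ℕ → ℝ) (H : ℕ → Prop)
    (nm : ℕ) [NeZero nm] (μ₀ : Fin (d + 1)) {q : Consts190} {δr : ℝ}
    (hδr : 0 < δr) (hσ₀ : 0 < q.σ) (hcR : B6.c0 δr (q.σ / δr) ^ (d + 1) ≤ q.cR) (hκB : 1 ≤ q.κB)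
    (hδ15 : q.δ15 ≤ 4 * (rateH (d + 1) / ((d : ℝ) + 1)))
    (hCst : CH0 (d + 1) * ((d + 1 : ℕ) : ℝ) * K₁ (d + 1) (rateH (d + 1) / ((d : ℝ) + 1) / 2) ≤ q.Cst)
    (hm1 : 1 ≤ q.m) (hθ : 0 ≤ q.θ) (hθM : q.θ * Mc ≤ 1) :
    ∃ 𝒟 : Data190 (d + 1) Mc N (fun n => Tor (fine nm (fun _ : Fin (d + 1) => N n * Mc)) × Fin (d + 1) → ℂ) q,
      ∀ (n : ℕ) (X : TDom (d + 1) (N n)) (y : TPt (d + 1) (N n * Mc)),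
        𝒟.hn n X y = fun p : Tor (fine nm (fun _ : Fin (d + 1) => N n * Mc)) × Fin (d + 1) =>
          if tcubeOf (N n) Mc (B5Blocks16.blockOf nm (fun _ : Fin (d + 1) => N n * Mc) p.1) ∈ X.1 then
            (HkOp nm (fun _ : Fin (d + 1) => N n * Mc) *ᵥ (Pi.single (y, μ₀) (1 : ℂ))) p
          else 0 :=
  exists_data190_twoGrid_of_rowMajorant I i₀ η L Mg R H
    (fun n => Tor (fun _ : Fin (d + 1) => N n * Mc) × Fin (d + 1))
    (fun n => Tor (fine nm (fun _ : Fin (d + 1) => N n * Mc)) × Fin (d + 1))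
    (fun n (b : Tor (fun _ : Fin (d + 1) => N n * Mc) × Fin (d + 1)) => b.1)
    (fun n (p : Tor (fine nm (fun _ : Fin (d + 1) => N n * Mc)) × Fin (d + 1)) =>
      B5Blocks16.blockOf nm (fun _ : Fin (d + 1) => N n * Mc) p.1)
    (fun n (y : TPt (d + 1) (N n * Mc)) => (y, μ₀)) (fun _ _ => rfl) (d + 1)
    (fun n y => (card_fibre_fst (β := Fin (d + 1)) y).le.trans (by rw [Fintype.card_fin]))
    (fun n => ((HkOp nm (fun _ : Fin (d + 1) => N n * Mc)).mulVecLin).restrictScalars ℝ)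
    (CH0_nonneg d) (rateH_div_pos d)
    (fun n B p => rowMajorant_HkOp nm (N n * Mc) B p)
    hδr hσ₀ hcR hκB hδ15 hCst hm1 hθ hθM

/-- **ONE CONSTANT RECORD FOR ALL STEPS AND VOLUMES** — the uniformity of the (190)-constants in the step `k`, which the
chain DISPLAYS as a hypothesis shape (`RemainderDecay190`: *"q ONE for all scales k, histories p and volumes n"*), is a
THEOREM for the flat `H_k`: with `ρ := rateH(D)∕D` and the explicit record `q⋆ = ⟨Cst := CH0(D)·D·K₁(D, ρ∕2), δ15 := 4ρ,
σ := ρ∕4, τ := ρ∕4, cR := c₀(ρ, ¼)^D, m := 1, θ := 1∕M, κB := 1⟩` one has `q⋆.Valid (ρ∕(4M))` (the chain's compatibility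
clause at the derived p. 282 rate `δ₀ = τθ = ρ∕(4M)`) AND, for every mesh `nm`, every volume sequence `N`, every source
direction `μ₀` (and every index set of (4.4)-sizes, every geometry weights), NODE D's socket inhabited by `H_k` with
THIS `q⋆`. [cite: Balaban1987RG1, p.282, (5.10) p.293; Balaban1985Variational, (190) p.308; Balaban1984PropagatorsII, Cor. 2.8 (2.151) p.249, Lemma 2.1 (2.61) p.234] -/
theorem exists_consts190_twoGrid_HkOp (d Mc : ℕ) [NeZero Mc] :
    ∃ q : Consts190, q.Valid (rateH (d + 1) / ((d : ℝ) + 1) / (4 * Mc)) ∧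
      ∀ (I : Type) (_ : I) (η L Mg R : ℕ → ℝ) (H : ℕ → Prop) (N : ℕ → ℕ) [∀ n, NeZero (N n)]
        (nm : ℕ) [NeZero nm] (μ₀ : Fin (d + 1)),
        ∃ 𝒟 : Data190 (d + 1) Mc N (fun n => Tor (fine nm (fun _ : Fin (d + 1) => N n * Mc)) × Fin (d + 1) → ℂ) q,
          ∀ (n : ℕ) (X : TDom (d + 1) (N n)) (y : TPt (d + 1) (N n * Mc)),
            𝒟.hn n X y = fun p : Tor (fine nm (fun _ : Fin (d + 1) => N n * Mc)) × Fin (d + 1) =>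
              if tcubeOf (N n) Mc (B5Blocks16.blockOf nm (fun _ : Fin (d + 1) => N n * Mc) p.1) ∈ X.1 then
                (HkOp nm (fun _ : Fin (d + 1) => N n * Mc) *ᵥ (Pi.single (y, μ₀) (1 : ℂ))) p
              else 0 := by
  set ρ : ℝ := rateH (d + 1) / ((d : ℝ) + 1) with hρ_def
  have hρ : 0 < ρ := rateH_div_pos d
  have hMc : (0 : ℝ) < Mc := by exact_mod_cast Nat.pos_of_ne_zero (NeZero.ne Mc)
  have hc0 : 0 ≤ B6.c0 ρ (1 / 4) := by unfold B6.c0; exact tsum_nonneg fun z => (Real.exp_pos _).le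
  refine ⟨⟨CH0 (d + 1) * ((d + 1 : ℕ) : ℝ) * K₁ (d + 1) (ρ / 2), 4 * ρ, ρ / 4, ρ / 4, B6.c0 ρ (1 / 4) ^ (d + 1), 1,
    1 / Mc, 1⟩, ?_, ?_⟩
  · refine ⟨?_, ?_, zero_le_one, zero_le_one, by positivity, ?_, ?_⟩
    · exact mul_nonneg (mul_nonneg (CH0_nonneg d) (Nat.cast_nonneg _)) (K₁_nonneg _ _)
    · exact pow_nonneg hc0 _
    · show ρ / 4 + ρ / 4 ≤ 4 * ρ / 8
      linarith
    · show rateH (d + 1) / ((d : ℝ) + 1) / (4 * Mc) ≤ ρ / 4 * (1 / Mc)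
      rw [← hρ_def]
      have e : ρ / (4 * Mc) = ρ / 4 * (1 / Mc) := by field_simp
      rw [e]
  · intro I i₀ η L Mg R H N _ nm _ μ₀
    refine exists_data190_twoGrid_HkOp I i₀ η L Mg R H nm μ₀ (δr := ρ) hρ (by show 0 < ρ / 4; positivity) ?_ le_rfl
      ?_ ?_ le_rfl ?_ ?_
    · show B6.c0 ρ (ρ / 4 / ρ) ^ (d + 1) ≤ B6.c0 ρ (1 / 4) ^ (d + 1)
      have e : ρ / 4 / ρ = 1 / 4 := by field_simp
      rw [e]
    · show 4 * ρ ≤ 4 * (rateH (d + 1) / ((d : ℝ) + 1))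
      rw [← hρ_def]
    · show CH0 (d + 1) * ((d + 1 : ℕ) : ℝ) * K₁ (d + 1) (rateH (d + 1) / ((d : ℝ) + 1) / 2) ≤
        CH0 (d + 1) * ((d + 1 : ℕ) : ℝ) * K₁ (d + 1) (ρ / 2)
      rw [← hρ_def]
    · show (0 : ℝ) ≤ 1 / Mc
      positivity
    · show 1 / (Mc : ℝ) * Mc ≤ 1
      rw [one_div_mul_cancel hMc.ne']

end Socket

end

end Literature.MathematicalPhysics.QuantumFieldTheory.Balaban1983to89.Beta.RemainderDecay190TwoGridHk
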